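import Literature.Probability.RandomPlanarGeometry.RadialBesselContraction
import Literature.Probability.RandomPlanarGeometry.RadialBesselBoundary
import HarnessLib

/-!
# The radial Bessel process of SLE_κ does not hit `{0, 2π}` for `κ ≤ 4`

Topic `Probability/RandomPlanarGeometry`; theorems only, sequel of `RadialBesselSLE` /
`RadialBesselLifetime` / `RadialBesselBoundary`. For the SLE_κ radial Bessel process
`dYₜ = cot(Yₜ/2) dt - √κ dBₜ` on `(0, 2π)` (LSW (2002), (2.11); Lawler (2005), (1.16) with
`a = 2/κ`, (6.13)) started at `θ ∈ (0, 2π)`, the lifetime `T` (`sleLifetime`, the exit time from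
`(0, 2π)`, `= ⨆ₙ σₙ`) is **almost surely infinite when `κ ≤ 4`** (`ae_sleLifetime_eq_top`):
Lawler (2005), §1.11, Lemma 1.27 in the time scale of (1.16) ("if `a ≥ 1/2` then w.p.1 `T = ∞`",
`a = 2/κ`), and §6.4 (radial SLE_κ swallows no boundary point when `κ ≤ 4`). Equivalently, in
the language of Miller–Sheffield (2017), §2.1.2: the solution of
`dθ = ((ρ+2)/2) cot(θ/2) dt + √κ dB` (their (2.5); here `ρ = 0`, the general case reduces to it by
the time change absorbing `(ρ+2)/2`) has Bessel dimension `d = 1 + 4/κ ≥ 2` near the endpoints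
and does not reach them.

The proof is by the logarithmic Lyapunov function `G(y) = -log sin(y/2) ≥ 0`, which is `C²` on
`(0, 2π)`, tends to `+∞` at both endpoints, and satisfies

  `Λ₀ G = (κ/8)/sin²(y/2) - cot²(y/2)/2 = 1/2 + (κ/8 - 1/2)/sin²(y/2) ≤ 1/2`  (`κ ≤ 4`)

(`expGenerator_negLogSinHalf_le`). Dynkin's formula at the level exit times `σₙ`
(`RadialBesselContinuity.integral_apply_stoppedProcess_eq`) gives `E[G(Y_{t∧σₙ})] ≤ G(θ) + t/2`,
while on `{σₙ ≤ t}` the stopped flow sits at an endpoint of the level-`n` interval, where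
`G = -log sin δₙ =: vₙ → ∞`; hence `P[σₙ ≤ t] ≤ (G(θ) + t/2)/vₙ → 0`, `P[T ≤ t] = 0` for every
`t`, and `T = ∞` a.s. No scale function and no comparison with Bessel processes is needed.
Consequences: `ae_forall_sleArg_mem_Ioo` (a.s. the maximal flow `RadialLoewner.arg` stays in
`(0, 2π)` for all times) and `ae_eventually_lt_sleExitLevel` (`σₙ → ∞` a.s.).

## References

* G. F. Lawler, *Conformally Invariant Processes in the Plane*, AMS (2005), §1.11 (eq. (1.16),
  Prop. 1.26, Lemma 1.27), §6.4. [Lawler2005]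
* G. F. Lawler, O. Schramm, W. Werner, *One-arm exponent for critical 2D percolation*, Electron.
  J. Probab. 7 (2002), no. 2, §2 (2.11). [LawlerSchrammWernerEJP2002]
* J. Miller, S. Sheffield, *Imaginary geometry IV*, Probab. Theory Related Fields 169 (2017),
  arXiv:1302.4738, §2.1.2 (eq. (2.5), `d(ρ, κ) = 1 + 2(ρ+2)/κ`). [MillerSheffield2013]
-/

noncomputable section

open MeasureTheory ProbabilityTheory Filter Topology Set
open scoped NNReal ENNReal

namespace Literature.Probability.RandomPlanarGeometry

namespace RadialLoewner

open Literature.Probability.Process Literature.Analysis.FunctionSpaces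

variable {κ : ℝ≥0} {n : ℕ} {θ : ℝ}

/-! ### The logarithmic Lyapunov function `-log sin(y/2)` -/

section LogLyap

/-- `-log sin(y/2) ≥ 0` everywhere (`|sin| ≤ 1`, and Mathlib's `log` is `log |·|`). [folklore] -/
theorem negLogSinHalf_nonneg (y : ℝ) : 0 ≤ -Real.log (Real.sin (y / 2)) := by
  rw [neg_nonneg, ← Real.log_abs]
  exact Real.log_nonpos (abs_nonneg _) (Real.abs_sin_le_one _)

/-- `d/dy (-log sin(y/2)) = -(1/2) cot(y/2)` on `(0, 2π)`. [folklore] -/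
theorem hasDerivAt_negLogSinHalf {y : ℝ} (hy : y ∈ Ioo 0 (2 * Real.pi)) :
    HasDerivAt (fun y ↦ -Real.log (Real.sin (y / 2))) (-(1 / 2) * Real.cot (y / 2)) y := by
  have hs := sin_half_pos hy
  have h : HasDerivAt (fun y ↦ -Real.log (Real.sin (y / 2)))
      (-(Real.cos (y / 2) * (1 / 2) / Real.sin (y / 2))) y :=
    (((hasDerivAt_id' y).div_const 2).sin.log hs.ne').neg
  refine h.congr_deriv ?_
  rw [Real.cot_eq_cos_div_sin]
  field_simp

/-- `d/dy (-(1/2) cot(y/2)) = (1/4)/sin²(y/2)` on `(0, 2π)`. [folklore] -/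
theorem hasDerivAt_negHalfCotHalf {y : ℝ} (hy : y ∈ Ioo 0 (2 * Real.pi)) :
    HasDerivAt (fun y ↦ -(1 / 2) * Real.cot (y / 2)) ((1 / 4) * (Real.sin (y / 2) ^ 2)⁻¹) y := by
  have hs := sin_half_pos hy
  have h1 : HasDerivAt (fun y : ℝ ↦ y / 2) (1 / 2) y := (hasDerivAt_id' y).div_const 2
  have h2 : HasDerivAt (fun y : ℝ ↦ Real.cot (y / 2)) (-(Real.sin (y / 2) ^ 2)⁻¹ * (1 / 2)) y :=
    HasDerivAt.comp (h₂ := Real.cot) (h := fun z : ℝ ↦ z / 2) y (Real.hasDerivAt_cot hs.ne') h1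
  refine (h2.const_mul (-(1 / 2))).congr_deriv ?_
  ring

/-- The first derivative on `(0, 2π)`. [folklore] -/
theorem deriv_negLogSinHalf {y : ℝ} (hy : y ∈ Ioo 0 (2 * Real.pi)) :
    deriv (fun y ↦ -Real.log (Real.sin (y / 2))) y = -(1 / 2) * Real.cot (y / 2) :=
  (hasDerivAt_negLogSinHalf hy).deriv

/-- The derivative agrees with `-(1/2) cot(·/2)` near every point of `(0, 2π)`. [folklore] -/
theorem deriv_negLogSinHalf_eventuallyEq {y : ℝ} (hy : y ∈ Ioo 0 (2 * Real.pi)) :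
    deriv (fun y ↦ -Real.log (Real.sin (y / 2))) =ᶠ[𝓝 y] fun y ↦ -(1 / 2) * Real.cot (y / 2) := by
  filter_upwards [Ioo_mem_nhds hy.1 hy.2] with z hz
  exact deriv_negLogSinHalf hz

/-- The second derivative on `(0, 2π)`: `(1/4)/sin²(y/2)`. [folklore] -/
theorem iteratedDeriv_two_negLogSinHalf {y : ℝ} (hy : y ∈ Ioo 0 (2 * Real.pi)) :
    iteratedDeriv 2 (fun y ↦ -Real.log (Real.sin (y / 2))) y = (1 / 4) * (Real.sin (y / 2) ^ 2)⁻¹ := by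
  rw [iteratedDeriv_succ, iteratedDeriv_one, (deriv_negLogSinHalf_eventuallyEq hy).deriv_eq]
  exact (hasDerivAt_negHalfCotHalf hy).deriv

/-- `-log sin(·/2)` is `C²` on `(0, 2π)`. [folklore] -/
theorem contDiffOn_negLogSinHalf :
    ContDiffOn ℝ 2 (fun y ↦ -Real.log (Real.sin (y / 2))) (Ioo 0 (2 * Real.pi)) := by
  intro y hy
  have hs := sin_half_pos hy
  have h1 : ContDiffAt ℝ 2 (fun y : ℝ ↦ Real.sin (y / 2)) y :=
    Real.contDiff_sin.contDiffAt.comp y (contDiffAt_id.div_const 2)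
  exact (((Real.contDiffAt_log.2 hs.ne').comp y h1).neg).contDiffWithinAt

/-- **The Lyapunov inequality** `Λ₀(-log sin(·/2)) ≤ 1/2` on `(0, 2π)` for `κ ≤ 4`:
`Λ₀ G = (κ/8)/sin²(y/2) - cos²(y/2)/(2 sin²(y/2)) = 1/2 + (κ/8 - 1/2)/sin²(y/2)`.
This is where the hypothesis `κ ≤ 4` (Bessel dimension `1 + 4/κ ≥ 2`) enters. [folklore] -/
theorem expGenerator_negLogSinHalf_le (hκ : κ ≤ 4) {y : ℝ} (hy : y ∈ Ioo 0 (2 * Real.pi)) :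
    expGenerator κ 0 (fun y ↦ -Real.log (Real.sin (y / 2))) y ≤ 1 / 2 := by
  have hs := sin_half_pos hy
  have hκ' : ((κ : ℝ≥0) : ℝ) ≤ 4 := by exact_mod_cast hκ
  rw [expGenerator_apply, iteratedDeriv_two_negLogSinHalf hy, deriv_negLogSinHalf hy, zero_mul,
    add_zero, Real.cot_eq_cos_div_sin]
  set s := Real.sin (y / 2) with hsdef
  set c := Real.cos (y / 2) with hcdef
  have hcs : c ^ 2 = 1 - s ^ 2 := by rw [hcdef, hsdef, Real.cos_sq']
  have key : (κ : ℝ) / 2 * (1 / 4 * (s ^ 2)⁻¹) + c / s * (-(1 / 2) * (c / s)) =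
      ((κ : ℝ) / 8 - c ^ 2 / 2) / s ^ 2 := by
    field_simp
    ring
  rw [key, div_le_iff₀ (by positivity), hcs]
  nlinarith [sq_nonneg s]

end LogLyap

/-! ### Dynkin bound with a bounded generator -/

/-- `F(Y_{t∧σₙ})` is integrable for `F ∈ C²` (start inside): it is bounded. [folklore] -/
theorem integrable_apply_stoppedProcess_sleArgLevel
    (hθn : θ ∈ Ioo (2 * level n) (2 * Real.pi - 2 * level n)) {F : ℝ → ℝ} (hF : ContDiff ℝ 2 F)
    (t : ℝ≥0) :
    Integrable (fun ω ↦ F (stoppedProcess (sleArgLevel κ n θ) (sleExitLevel κ n θ) t ω))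
      preWienerMeasure := by
  have h := integrable_expClock_mul (κ := κ) hθn hF 0 t
  refine h.congr (Eventually.of_forall fun ω ↦ ?_)
  simp only [expClock_apply, zero_mul, Real.exp_zero, one_mul]

/-- **`E[G(Y_{t∧σₙ})] ≤ G(θ) + C t`** for `G ∈ C²(ℝ)` with `Λ₀ G ≤ C` (`C ≥ 0`) on the level-`n`
interval (start inside): Dynkin's formula at `σₙ` and `∫₀^{t∧σₙ} (Λ₀G)(Y_s) ds ≤ C (t ∧ σₙ) ≤ C t`.
[folklore] -/
theorem integral_stoppedProcess_le_of_expGenerator_le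
    (hθn : θ ∈ Ioo (2 * level n) (2 * Real.pi - 2 * level n))
    {G : ℝ → ℝ} (hG : ContDiff ℝ 2 G) {C : ℝ} (hC : 0 ≤ C)
    (hGen : ∀ y ∈ Icc (2 * level n) (2 * Real.pi - 2 * level n), expGenerator κ 0 G y ≤ C) (t : ℝ≥0) :
    ∫ ω, G (stoppedProcess (sleArgLevel κ n θ) (sleExitLevel κ n θ) t ω) ∂preWienerMeasure ≤
      G θ + C * t := by
  haveI := isProbabilityMeasure_preWienerMeasure'
  have hτ := isStoppingTime_sleExitLevel κ n θ
  have hτσ : ∀ ω, sleExitLevel κ n θ ω ≤ sleExitLevel κ n θ ω := fun ω ↦ le_rfl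
  have hdyn := integral_apply_stoppedProcess_eq hθn hG hτ hτσ t
  have hIi := integrable_intervalIntegral_expGenerator hθn hG hτ hτσ t
  -- the generator term is `≤ C t` pathwise
  have hup : ∀ ω, (∫ s in (0 : ℝ)..(((min (t : WithTop ℝ≥0) (sleExitLevel κ n θ ω)).untopA : ℝ≥0) : ℝ),
      expGenerator κ 0 G (sleArgLevel κ n θ s.toNNReal ω)) ≤ C * t := by
    intro ω
    set r := (((min (t : WithTop ℝ≥0) (sleExitLevel κ n θ ω)).untopA : ℝ≥0) : ℝ) with hr
    have hr0 : 0 ≤ r := NNReal.coe_nonneg _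
    have hrt : r ≤ t := by exact_mod_cast untopA_min_coe_le t (sleExitLevel κ n θ ω)
    have hle : ∀ s ∈ Icc 0 r, expGenerator κ 0 G (sleArgLevel κ n θ s.toNNReal ω) ≤ C := by
      intro s hs
      have hsσ : ((s.toNNReal : ℝ≥0) : WithTop ℝ≥0) ≤ sleExitLevel κ n θ ω :=
        (WithTop.coe_le_coe.2 ((Real.toNNReal_le_iff_le_coe).2 hs.2)).trans (coe_untopA_min_le _ _)
      exact hGen _ (argTrunc_mem_Icc_of_le_truncExit _ (level_pos n) (level_le n) hθn ω hsσ)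
    have hcont : ContinuousOn (fun s ↦ expGenerator κ 0 G (sleArgLevel κ n θ s.toNNReal ω)) (Icc 0 r) := by
      have hc1 : Continuous fun s : ℝ ↦ sleArgLevel κ n θ s.toNNReal ω :=
        (continuous_sleArgLevel κ n θ ω).comp continuous_real_toNNReal
      refine (continuousOn_expGenerator κ 0 hG).comp hc1.continuousOn fun s hs ↦ ?_
      have hsσ : ((s.toNNReal : ℝ≥0) : WithTop ℝ≥0) ≤ sleExitLevel κ n θ ω :=
        (WithTop.coe_le_coe.2 ((Real.toNNReal_le_iff_le_coe).2 hs.2)).trans (coe_untopA_min_le _ _)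
      exact Icc_level_subset_Ioo n (argTrunc_mem_Icc_of_le_truncExit _ (level_pos n) (level_le n) hθn ω hsσ)
    have hmono := intervalIntegral.integral_mono_on hr0 (hcont.intervalIntegrable_of_Icc hr0)
      (intervalIntegrable_const (μ := volume) (c := C)) (fun s hs ↦ hle s hs)
    rw [intervalIntegral.integral_const, smul_eq_mul, sub_zero] at hmono
    calc _ ≤ r * C := hmono
      _ ≤ t * C := mul_le_mul_of_nonneg_right hrt hC
      _ = C * t := mul_comm _ _
  have hmono := integral_mono hIi (integrable_const (C * (t : ℝ))) hup
  rw [integral_const, probReal_univ, one_smul] at hmono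
  rw [hdyn]
  linarith

/-! ### Non-hitting for `κ ≤ 4` -/

/-- The value of the Lyapunov function at the endpoints of the level-`n` interval,
`vₙ = -log sin δₙ`, is positive (`0 < δₙ ≤ 1 < π/2`). [folklore] -/
theorem negLogSin_level_pos (n : ℕ) : 0 < -Real.log (Real.sin (level n)) := by
  rw [neg_pos]
  refine Real.log_neg (sin_level_pos (level_pos n) (level_le n)) ?_
  have h1 : level n < Real.pi / 2 := by linarith [level_le_one n, Real.pi_gt_three]
  rw [← Real.sin_pi_div_two]
  exact Real.sin_lt_sin_of_lt_of_le_pi_div_two (by linarith [level_pos n, Real.pi_pos]) le_rfl h1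

/-- `vₙ = -log sin δₙ → ∞`. [folklore] -/
theorem tendsto_negLogSin_level : Tendsto (fun n ↦ -Real.log (Real.sin (level n))) atTop atTop := by
  have h1 : Tendsto (fun n ↦ Real.sin (level n)) atTop (𝓝[>] 0) := by
    refine tendsto_nhdsWithin_iff.2 ⟨?_, Eventually.of_forall fun n ↦ ?_⟩
    · have h := (Real.continuous_sin.tendsto 0).comp tendsto_level
      rw [Real.sin_zero] at h
      exact h
    · exact sin_level_pos (level_pos n) (level_le n)
  exact tendsto_neg_atBot_atTop.comp (Real.tendsto_log_nhdsGT_zero.comp h1)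

/-- **`P[σₙ ≤ t] ≤ (G(θ) + t/2)/vₙ`** (`κ ≤ 4`, start inside the level-`n` interval,
`G = -log sin(·/2)`, `vₙ = -log sin δₙ`): on `{σₙ ≤ t}` the stopped flow is at `2δₙ` or `2π - 2δₙ`,
where `G = vₙ`, and `E[G(Y_{t∧σₙ})] ≤ G(θ) + t/2` by the Lyapunov inequality. [folklore] -/
theorem measureReal_sleExitLevel_le_le (hκ : κ ≤ 4)
    (hθn : θ ∈ Ioo (2 * level n) (2 * Real.pi - 2 * level n)) (t : ℝ≥0) :
    preWienerMeasure.real {ω | sleExitLevel κ n θ ω ≤ (t : WithTop ℝ≥0)} ≤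
      (-Real.log (Real.sin (θ / 2)) + 1 / 2 * t) / (-Real.log (Real.sin (level n))) := by
  haveI := isProbabilityMeasure_preWienerMeasure'
  set G : ℝ → ℝ := fun y ↦ -Real.log (Real.sin (y / 2)) with hGdef
  set v := -Real.log (Real.sin (level n)) with hv
  have hv0 : 0 < v := negLogSin_level_pos n
  -- a global `C²` version of `G` near the level interval
  obtain ⟨F, hF, hFeq⟩ := exists_contDiff_eventuallyEq contDiffOn_negLogSinHalf (level_pos n) (level_lt_pi n)
  have hFval : ∀ y ∈ Icc (2 * level n) (2 * Real.pi - 2 * level n), F y = G y := fun y hy ↦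
    (hFeq y (Icc_level_subset_Ioo_level n hy)).eq_of_nhds
  have hF0 : ∀ y ∈ Icc (2 * level n) (2 * Real.pi - 2 * level n), 0 ≤ F y := fun y hy ↦ by
    rw [hFval y hy]; exact negLogSinHalf_nonneg y
  have hFgen : ∀ y ∈ Icc (2 * level n) (2 * Real.pi - 2 * level n), expGenerator κ 0 F y ≤ 1 / 2 :=
    fun y hy ↦ by
      rw [expGenerator_congr (hFeq y (Icc_level_subset_Ioo_level n hy))]
      exact expGenerator_negLogSinHalf_le hκ (Icc_level_subset_Ioo n hy)
  have hE := integral_stoppedProcess_le_of_expGenerator_le hθn hF (by norm_num) hFgen t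
  rw [hFval θ ⟨hθn.1.le, hθn.2.le⟩] at hE
  -- `F` at the endpoints
  have hend : ∀ ω, sleExitLevel κ n θ ω ≤ (t : WithTop ℝ≥0) →
      F (stoppedProcess (sleArgLevel κ n θ) (sleExitLevel κ n θ) t ω) = v := by
    intro ω hω
    obtain ⟨s, hs⟩ := WithTop.ne_top_iff_exists.1 (ne_top_of_le_ne_top WithTop.coe_ne_top hω)
    rw [stoppedProcess_eq_of_ge hω, ← hs, WithTop.untopA_eq_untop WithTop.coe_ne_top, WithTop.untop_coe]
    have hval := argTrunc_truncExit_eq_or (continuous_sleDriving' κ) (level_pos n) (level_le n) hθn ω hs.symm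
    have hl := level_pos n
    have hl1 := level_le_one n
    rcases hval with h | h
    · rw [show sleArgLevel κ n θ s ω = 2 * level n from h,
        hFval _ ⟨le_rfl, by linarith [Real.pi_gt_three]⟩, hGdef]
      simp only
      rw [show 2 * level n / 2 = level n by ring]
    · rw [show sleArgLevel κ n θ s ω = 2 * Real.pi - 2 * level n from h,
        hFval _ ⟨by linarith [Real.pi_gt_three], le_rfl⟩, hGdef]
      simp only
      rw [show (2 * Real.pi - 2 * level n) / 2 = Real.pi - level n by ring, Real.sin_pi_sub]
  -- Chebyshev: `v · P[σₙ ≤ t] ≤ E[F(Y_{t∧σₙ})]`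
  set A := {ω : ℝ≥0 → ℝ | sleExitLevel κ n θ ω ≤ (t : WithTop ℝ≥0)} with hA
  have hAm : MeasurableSet A := brownianFiltration.le t _ ((isStoppingTime_sleExitLevel κ n θ) t)
  have hint : Integrable (fun ω ↦ F (stoppedProcess (sleArgLevel κ n θ) (sleExitLevel κ n θ) t ω))
      preWienerMeasure := integrable_apply_stoppedProcess_sleArgLevel hθn hF t
  have hind : ∀ ω, v * A.indicator (fun _ ↦ (1 : ℝ)) ω ≤
      F (stoppedProcess (sleArgLevel κ n θ) (sleExitLevel κ n θ) t ω) := by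
    intro ω
    by_cases hω : ω ∈ A
    · rw [indicator_of_mem hω, mul_one, hend ω hω]
    · rw [indicator_of_notMem hω, mul_zero]
      exact hF0 _ (stoppedProcess_sleArgLevel_mem_Icc hθn t ω)
  have hmono := integral_mono (((integrable_const (1 : ℝ)).indicator hAm).const_mul v) hint hind
  rw [integral_const_mul, integral_indicator_const _ hAm, smul_eq_mul, mul_one] at hmono
  rw [le_div_iff₀ hv0]
  calc preWienerMeasure.real A * v = v * preWienerMeasure.real A := mul_comm _ _
    _ ≤ _ := hmono
    _ ≤ _ := hE

/-- **`P[T ≤ t] = 0` for every `t`** (`κ ≤ 4`, `θ ∈ (0, 2π)`): `{T ≤ t} ⊆ {σₙ ≤ t}` for all `n`,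
and `P[σₙ ≤ t] ≤ (G(θ) + t/2)/vₙ → 0`. [cite: Lawler2005, §1.11 Lemma 1.27] -/
theorem measure_sleLifetime_le_eq_zero (hκ : κ ≤ 4) (hθ : θ ∈ Ioo 0 (2 * Real.pi)) (t : ℝ≥0) :
    preWienerMeasure {ω | sleLifetime κ θ ω ≤ (t : WithTop ℝ≥0)} = 0 := by
  haveI := isProbabilityMeasure_preWienerMeasure'
  obtain ⟨N₀, hN₀⟩ := eventually_mem_Ioo_level hθ
  set B := {ω : ℝ≥0 → ℝ | sleLifetime κ θ ω ≤ (t : WithTop ℝ≥0)} with hB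
  have hsub : ∀ n, B ⊆ {ω | sleExitLevel κ n θ ω ≤ (t : WithTop ℝ≥0)} := fun n ω (hω : _ ≤ _) ↦
    (exitLevel_le_lifetime (continuous_sleDriving' κ) n θ ω).trans hω
  have hle : ∀ n, N₀ ≤ n → preWienerMeasure.real B ≤
      (-Real.log (Real.sin (θ / 2)) + 1 / 2 * t) / (-Real.log (Real.sin (level n))) := fun n hn ↦
    (measureReal_mono (hsub n)).trans (measureReal_sleExitLevel_le_le hκ (hN₀ n hn) t)
  have hlim : Tendsto (fun n ↦ (-Real.log (Real.sin (θ / 2)) + 1 / 2 * t) /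
      (-Real.log (Real.sin (level n)))) atTop (𝓝 0) :=
    tendsto_const_nhds.div_atTop tendsto_negLogSin_level
  have hB0 : preWienerMeasure.real B ≤ 0 :=
    ge_of_tendsto hlim (eventually_atTop.2 ⟨N₀, hle⟩)
  have hB0' : preWienerMeasure.real B = 0 := le_antisymm hB0 measureReal_nonneg
  exact (measureReal_eq_zero_iff (measure_ne_top _ _)).1 hB0'

/-- **The radial Bessel process of SLE_κ, `κ ≤ 4`, never leaves `(0, 2π)`: `T = ∞` almost
surely** (start `θ ∈ (0, 2π)`). Lawler (2005), §1.11, Lemma 1.27 (`a = 2/κ ≥ 1/2`), §6.4;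
Miller–Sheffield (2017), §2.1.2 (`d(ρ, κ) ≥ 2`). [cite: Lawler2005, §1.11 Lemma 1.27] -/
theorem ae_sleLifetime_eq_top (hκ : κ ≤ 4) (hθ : θ ∈ Ioo 0 (2 * Real.pi)) :
    ∀ᵐ ω ∂preWienerMeasure, sleLifetime κ θ ω = ⊤ := by
  have hnull : preWienerMeasure {ω | sleLifetime κ θ ω < ⊤} = 0 := by
    have hcover : {ω : ℝ≥0 → ℝ | sleLifetime κ θ ω < ⊤} ⊆
        ⋃ k : ℕ, {ω | sleLifetime κ θ ω ≤ ((k : ℝ≥0) : WithTop ℝ≥0)} := by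
      intro ω (hω : sleLifetime κ θ ω < ⊤)
      obtain ⟨s, hs⟩ := WithTop.ne_top_iff_exists.1 hω.ne
      obtain ⟨k, hk⟩ := exists_nat_ge (s : ℝ)
      refine mem_iUnion.2 ⟨k, ?_⟩
      change sleLifetime κ θ ω ≤ ((k : ℝ≥0) : WithTop ℝ≥0)
      rw [← hs, WithTop.coe_le_coe, ← NNReal.coe_le_coe]
      exact_mod_cast hk
    refine measure_mono_null hcover (measure_iUnion_null fun k ↦ ?_)
    exact measure_sleLifetime_le_eq_zero hκ hθ k
  rw [ae_iff]
  refine measure_mono_null (fun ω (hω : ¬ sleLifetime κ θ ω = ⊤) ↦ ?_) hnull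
  exact lt_top_iff_ne_top.2 hω

/-- The event `{T = ∞}` has full measure (`κ ≤ 4`, `θ ∈ (0, 2π)`). [folklore] -/
theorem measure_sleLifetime_eq_top (hκ : κ ≤ 4) (hθ : θ ∈ Ioo 0 (2 * Real.pi)) :
    preWienerMeasure {ω | sleLifetime κ θ ω = ⊤} = 1 := by
  haveI := isProbabilityMeasure_preWienerMeasure'
  rw [← prob_compl_eq_zero_iff (measurableSet_sleLifetime_eq_top κ θ), compl_setOf]
  exact ae_iff.1 (ae_sleLifetime_eq_top hκ hθ)

/-- **Almost surely the radial Bessel flow stays in `(0, 2π)` for all times** (`κ ≤ 4`,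
`θ ∈ (0, 2π)`); the flow here is the maximal flow `RadialLoewner.arg` of `RadialBesselExit`.
[cite: Lawler2005, §1.11 Lemma 1.27] -/
theorem ae_forall_sleArg_mem_Ioo (hκ : κ ≤ 4) (hθ : θ ∈ Ioo 0 (2 * Real.pi)) :
    ∀ᵐ ω ∂preWienerMeasure, ∀ t : ℝ≥0,
      arg (sleDriving κ) (continuous_sleDriving' κ) θ t ω ∈ Ioo 0 (2 * Real.pi) := by
  filter_upwards [ae_sleLifetime_eq_top hκ hθ] with ω hω t
  refine arg_mem_Ioo (continuous_sleDriving' κ) hθ ?_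
  change (t : WithTop ℝ≥0) < sleLifetime κ θ ω
  rw [hω]; exact WithTop.coe_lt_top t

/-- For every time `t`, almost surely `t < σₙ` for all large `n` (`κ ≤ 4`, `θ ∈ (0, 2π)`): the level
exit times tend to `T = ∞`. [folklore] -/
theorem ae_eventually_lt_sleExitLevel (hκ : κ ≤ 4) (hθ : θ ∈ Ioo 0 (2 * Real.pi)) (t : ℝ≥0) :
    ∀ᵐ ω ∂preWienerMeasure, ∀ᶠ n in atTop, (t : WithTop ℝ≥0) < sleExitLevel κ n θ ω := by
  filter_upwards [ae_sleLifetime_eq_top hκ hθ] with ω hω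
  have ht : (t : WithTop ℝ≥0) < sleLifetime κ θ ω := by rw [hω]; exact WithTop.coe_lt_top t
  obtain ⟨N, hN⟩ := eventually_lt_exitLevel (continuous_sleDriving' κ) ht
  exact eventually_atTop.2 ⟨N, hN⟩

end RadialLoewner

end Literature.Probability.RandomPlanarGeometry
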